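import Literature.MathematicalPhysics.KineticTheory.HardSphereUniformGas
import HarnessLib

/-!
# Rung-0 velocity factorisation of the local Gibbs law (`stub_velocityFactorisationRung0`, helper
# H2 of the crux line `even-rung-mean-variance`, `JParityClosure.EvenStressEnskog`,
# stmt-AtomisticToContinuum-13079)

For constant profiles `(a, u, θ)` the local Gibbs density of `N + 1` hard spheres is
`Z⁻¹ 𝟙_{no overlap}(x) a^{N+1} ∏ᵢ M_{1,u,θ}(vᵢ)`: positions and velocities are independent, the
position marginal is the configurational Gibbs measure `posGibbsMeasure` and the velocity marginal
is the product Gaussian `⊗ᵢ N(u, θ id) = Measure.pi fun _ => gaussMeasure u θ`.  The identity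
of measures `localGibbsMeasure_rung0_eq_map` (the rung-0 local Gibbs measure is the image of
`posGibbsMeasure ⊗ (⊗ᵢ N(u, θ id))` under `zipConfig : (x, v) ↦ ((xᵢ, vᵢ))ᵢ`) and the
hypothesis-free Bochner disintegration `integral_localGibbsLaw_rung0` are the Literature theorems
of `Literature/MathematicalPhysics/KineticTheory/HardSphereUniformGas.lean`; here we deduce

* the integrability transfer `integrable_localGibbsLaw_const_iff` and the iterated (Fubini) form
  `integral_localGibbsLaw_const_eq_integral_integral` of the disintegration (integrable
  observables);
* the factorisation `E[F(x) h(v)] = E_pos[F] · ∫ h d(⊗ᵢ N(u, θ id))`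
  (`integral_pos_mul_vel_localGibbsLaw_const`; `integral_prod_mul`, hypothesis-free), the position
  and velocity marginals (`integral_pos_localGibbsLaw_const`, `integral_vel_localGibbsLaw_const`);
* the registered stub `stub_velocityFactorisationRung0`.

All statements hold for every reduced diameter `σ`: when the configurational partition function
vanishes every measure in sight is the zero measure.  We also record (all parameters, no
hypotheses) that the configurational Gibbs measure, the local Gibbs measure and the local Gibbs law
are finite measures (`Z⁻¹ w` has finite integral: either `w` is integrable or `Z = ∫ w = 0`).

References: H. Spohn, *Large Scale Dynamics of Interacting Particles* (1991), Part I §2.3 (local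
equilibrium states); Fubini–Tonelli.
-/

noncomputable section

open MeasureTheory Set
open scoped ENNReal

namespace Summit.AtomisticToContinuum.HydrodynamicLimit.Theorems.EvenStressEnskog

open Literature.Analysis.FluidPDE Literature.MathematicalPhysics.KineticTheory

/-! ### Finiteness of the Gibbs measures (all parameters) -/

/-- A normalised density `Z⁻¹ w` with `Z = ∫ w` (Bochner integral, junk value `0`) always has
finite integral: either `w` is integrable, or `Z = 0` and the density vanishes. [folklore] -/
theorem hasFiniteIntegral_inv_integral_mul {α : Type*} [MeasurableSpace α] (μ : Measure α)
    (w : α → ℝ) : HasFiniteIntegral (fun x => (∫ y, w y ∂μ)⁻¹ * w x) μ := by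
  by_cases hw : Integrable w μ
  · exact (hw.const_mul _).hasFiniteIntegral
  · simp only [integral_undef hw, inv_zero, zero_mul]
    exact hasFiniteIntegral_zero _ _

/-- The configurational Gibbs measure is a finite measure, for every activity, diameter and
particle number (a plain theorem, used via `haveI`). [folklore] -/
theorem isFiniteMeasure_posGibbsMeasure (a₀ : T3 → ℝ) (ε : ℝ) (n : ℕ) :
    IsFiniteMeasure (posGibbsMeasure a₀ ε n) := by
  unfold posGibbsMeasure posPartition
  exact isFiniteMeasure_withDensity_ofReal (hasFiniteIntegral_inv_integral_mul volume _)

/-- The local Gibbs measure is a finite measure, for all profiles, reduced diameters and particle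
numbers (a plain theorem, used via `haveI`). [folklore] -/
theorem isFiniteMeasure_localGibbsMeasure (σ : ℝ) (a₀ : T3 → ℝ) (u₀ : T3 → V3) (θ₀ : T3 → ℝ)
    (N : ℕ) : IsFiniteMeasure (localGibbsMeasure σ a₀ u₀ θ₀ N) := by
  unfold localGibbsMeasure canonicalDensity canonicalPartition
  exact isFiniteMeasure_withDensity_ofReal (hasFiniteIntegral_inv_integral_mul volume _)

/-- The local Gibbs law is a finite measure, for all profiles, reduced diameters, particle numbers
and flows (a plain theorem, used via `haveI`). [folklore] -/
theorem isFiniteMeasure_localGibbsLaw (σ : ℝ) (a₀ : T3 → ℝ) (u₀ : T3 → V3) (θ₀ : T3 → ℝ)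
    (N : ℕ) (Φ : HardSphereFlow (Torus.geometry (Fin 3)) (hsDiameter σ N) (N + 1)) :
    IsFiniteMeasure (localGibbsLaw σ a₀ u₀ θ₀ N Φ) := by
  rw [localGibbsLaw_eq]
  exact isFiniteMeasure_localGibbsMeasure σ a₀ u₀ θ₀ N

/-! ### Rung 0: disintegration and velocity factorisation -/

/-- `zipConfig` is a measurable embedding (it is a measurable equivalence). [folklore] -/
theorem measurableEmbedding_zipConfig {n : ℕ} :
    MeasurableEmbedding (zipConfig : (Fin n → T3) × (Fin n → V3) → Config n (Fin 3) T3) :=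
  (MeasurableEquiv.arrowProdEquivProdArrow T3 V3 (Fin n)).symm.measurableEmbedding

/-- For constant profiles the velocity law given the positions is the product Gaussian
`⊗ᵢ N(u, θ id)`, whatever the positions. [folklore] -/
theorem velMeasure_const (u : V3) (θ : ℝ) {n : ℕ} (x : Fin n → T3) :
    velMeasure (fun _ => u) (fun _ => θ) x = Measure.pi fun _ : Fin n => gaussMeasure u θ := rfl

/-- Integrability against the rung-0 local Gibbs law is integrability of the pull-back along
`zipConfig` against `posGibbsMeasure ⊗ ⊗ᵢ N(u, θ id)`. [folklore] -/
theorem integrable_localGibbsLaw_const_iff {E : Type*} [NormedAddCommGroup E]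
    (σ : ℝ) {a θ : ℝ} (ha : 0 ≤ a) (hθ : 0 < θ) (u : V3) (N : ℕ)
    (Φ : HardSphereFlow (Torus.geometry (Fin 3)) (hsDiameter σ N) (N + 1))
    (G : Config (N + 1) (Fin 3) T3 → E) :
    Integrable G (localGibbsLaw σ (fun _ => a) (fun _ => u) (fun _ => θ) N Φ) ↔
      Integrable (fun p => G (zipConfig p))
        ((posGibbsMeasure (fun _ : T3 => a) (hsDiameter σ N) (N + 1)).prod
          (Measure.pi fun _ : Fin (N + 1) => gaussMeasure u θ)) := by
  rw [localGibbsLaw_eq, localGibbsMeasure_rung0_eq_map σ ha hθ u N,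
    measurableEmbedding_zipConfig.integrable_map_iff]
  rfl

/-- **Iterated Bochner disintegration at rung 0** (Fubini): for an observable `G` integrable
against the rung-0 local Gibbs law,
`∫ G d(localGibbsLaw) = ∫ posGibbsMeasure(dx) ∫ G (zipConfig (x, v)) (⊗ᵢ N(u, θ id))(dv)`.
[folklore] -/
theorem integral_localGibbsLaw_const_eq_integral_integral {E : Type*} [NormedAddCommGroup E]
    [NormedSpace ℝ E] (σ : ℝ) {a θ : ℝ} (ha : 0 ≤ a) (hθ : 0 < θ) (u : V3) (N : ℕ)
    (Φ : HardSphereFlow (Torus.geometry (Fin 3)) (hsDiameter σ N) (N + 1))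
    {G : Config (N + 1) (Fin 3) T3 → E}
    (hG : Integrable G (localGibbsLaw σ (fun _ => a) (fun _ => u) (fun _ => θ) N Φ)) :
    ∫ z, G z ∂(localGibbsLaw σ (fun _ => a) (fun _ => u) (fun _ => θ) N Φ) =
      ∫ x, ∫ v, G (zipConfig (x, v)) ∂(Measure.pi fun _ : Fin (N + 1) => gaussMeasure u θ)
        ∂posGibbsMeasure (fun _ : T3 => a) (hsDiameter σ N) (N + 1) := by
  haveI := isFiniteMeasure_posGibbsMeasure (fun _ : T3 => a) (hsDiameter σ N) (N + 1)
  rw [integral_localGibbsLaw_rung0 σ ha hθ u N Φ,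
    integral_prod _ ((integrable_localGibbsLaw_const_iff σ ha hθ u N Φ G).1 hG)]

/-- **Velocity factorisation at rung 0.** For constant profiles `a ≥ 0`, `θ > 0`, `u`, every flow
and all real observables `F` of the positions and `h` of the velocities (no hypotheses: Fubini for
products, with the Bochner junk conventions matching on both sides),
`E[F(x) h(v)] = (∫ F d posGibbsMeasure) · ∫ h d(⊗ᵢ N(u, θ id))`. [folklore] -/
theorem integral_pos_mul_vel_localGibbsLaw_const (σ : ℝ) {a θ : ℝ} (ha : 0 ≤ a) (hθ : 0 < θ)
    (u : V3) (N : ℕ) (Φ : HardSphereFlow (Torus.geometry (Fin 3)) (hsDiameter σ N) (N + 1))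
    (F : (Fin (N + 1) → T3) → ℝ) (h : (Fin (N + 1) → V3) → ℝ) :
    ∫ z, F (fun i => (z i).1) * h (fun i => (z i).2)
        ∂(localGibbsLaw σ (fun _ => a) (fun _ => u) (fun _ => θ) N Φ) =
      (∫ x, F x ∂posGibbsMeasure (fun _ : T3 => a) (hsDiameter σ N) (N + 1)) *
        ∫ v, h v ∂(Measure.pi fun _ : Fin (N + 1) => gaussMeasure u θ) := by
  haveI := isFiniteMeasure_posGibbsMeasure (fun _ : T3 => a) (hsDiameter σ N) (N + 1)
  rw [integral_localGibbsLaw_rung0 σ ha hθ u N Φ]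
  exact integral_prod_mul F h

/-- **Position marginal at rung 0**: position observables are integrated against the
configurational Gibbs measure (the velocity law is a probability measure). [folklore] -/
theorem integral_pos_localGibbsLaw_const {E : Type*} [NormedAddCommGroup E] [NormedSpace ℝ E]
    (σ : ℝ) {a θ : ℝ} (ha : 0 ≤ a) (hθ : 0 < θ) (u : V3) (N : ℕ)
    (Φ : HardSphereFlow (Torus.geometry (Fin 3)) (hsDiameter σ N) (N + 1))
    (F : (Fin (N + 1) → T3) → E) :
    ∫ z, F (fun i => (z i).1) ∂(localGibbsLaw σ (fun _ => a) (fun _ => u) (fun _ => θ) N Φ) =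
      ∫ x, F x ∂posGibbsMeasure (fun _ : T3 => a) (hsDiameter σ N) (N + 1) := by
  haveI := isFiniteMeasure_posGibbsMeasure (fun _ : T3 => a) (hsDiameter σ N) (N + 1)
  rw [integral_localGibbsLaw_rung0 σ ha hθ u N Φ]
  exact (integral_fun_fst F).trans (by rw [probReal_univ, one_smul])

/-- **Velocity marginal at rung 0**: velocity observables are integrated against the product
Gaussian `⊗ᵢ N(u, θ id)`, times the total mass of the configurational Gibbs measure (`1` once
`Z_pos > 0`, e.g. for `σ ≤ 1/2` and `a > 0`; `0` otherwise). [folklore] -/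
theorem integral_vel_localGibbsLaw_const {E : Type*} [NormedAddCommGroup E] [NormedSpace ℝ E]
    (σ : ℝ) {a θ : ℝ} (ha : 0 ≤ a) (hθ : 0 < θ) (u : V3) (N : ℕ)
    (Φ : HardSphereFlow (Torus.geometry (Fin 3)) (hsDiameter σ N) (N + 1))
    (h : (Fin (N + 1) → V3) → E) :
    ∫ z, h (fun i => (z i).2) ∂(localGibbsLaw σ (fun _ => a) (fun _ => u) (fun _ => θ) N Φ) =
      (posGibbsMeasure (fun _ : T3 => a) (hsDiameter σ N) (N + 1)).real univ •
        ∫ v, h v ∂(Measure.pi fun _ : Fin (N + 1) => gaussMeasure u θ) := by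
  haveI := isFiniteMeasure_posGibbsMeasure (fun _ : T3 => a) (hsDiameter σ N) (N + 1)
  rw [integral_localGibbsLaw_rung0 σ ha hθ u N Φ]
  exact integral_fun_snd h

/-- **H2 · velocities are i.i.d. Maxwellian and independent of the positions at rung 0**
(registered helper stub `stub_velocityFactorisationRung0` of the line `even-rung-mean-variance`).
For constant profiles `a, θ > 0`, `u`, every `σ`, `N`, flow `Φ`, and observables `F` of the
positions and `h` of the velocities (the measurability and boundedness hypotheses of the
registered signature are not needed),
`E[F(x) h(v)] = E[F(x)] · ∫ h d(⊗ᵢ N(u, θ id))` under `localGibbsLaw σ a u θ N Φ`. [folklore] -/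
theorem stub_velocityFactorisationRung0 :
    ∀ (σ a θ : ℝ) (u : V3) (N : ℕ)
      (Φ : HardSphereFlow (Torus.geometry (Fin 3)) (hsDiameter σ N) (N + 1))
      (F : (Fin (N + 1) → T3) → ℝ) (h : (Fin (N + 1) → V3) → ℝ),
      0 < a → 0 < θ → Measurable F → Measurable h → (∃ C : ℝ, ∀ x, |F x| ≤ C) → (∃ C : ℝ, ∀ v, |h v| ≤ C) →
      ∫ z, F (fun i => (z i).1) * h (fun i => (z i).2) ∂(localGibbsLaw σ (fun _ => a) (fun _ => u) (fun _ => θ) N Φ) =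
        (∫ z, F (fun i => (z i).1) ∂(localGibbsLaw σ (fun _ => a) (fun _ => u) (fun _ => θ) N Φ)) *
          ∫ v, h v ∂(Measure.pi fun _ : Fin (N + 1) => gaussMeasure u θ) := by
  intro σ a θ u N Φ F h ha hθ _ _ _ _
  rw [integral_pos_mul_vel_localGibbsLaw_const σ ha.le hθ u N Φ F h,
    integral_pos_localGibbsLaw_const σ ha.le hθ u N Φ F]

end Summit.AtomisticToContinuum.HydrodynamicLimit.Theorems.EvenStressEnskog

end
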